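import Summits.Ventures.GridStability.Bench.SMIBDeg2AK13postD10VlevD5o2Data
import Mathlib.Tactic.LinearCombination
import Mathlib.Tactic.Positivity

/-!
# SMIBDeg2AK13postD10VlevD5o2 — THEOREMS part (kernel checks + certified inequalities)

Data (model block, `Poly`/`GramSOS`/`CertG` literals) live in `SMIBDeg2AK13postD10VlevD5o2Data.lean` (statement-only sibling);
this file holds one `SOS.Poly.checkG … = true := by decide +kernel` theorem per identity and the real-variable
inequalities derived by `nonneg_of_checkG`. See the Data file's docstring for the THREE-COLUMN text, model, provenance.
-/

namespace Summit.Ventures.GridStability.Bench.SMIB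

open Literature.Computation.Certificates Literature.Computation.Certificates.SOS
open Literature.Computation.Certificates.SOS.Poly

/-- KERNEL CHECK `deg2_A_K13postD10_vlevD5o2_V_pos`: every Gram block passes `PSD.IsGramCertDD` and the residual `p − (σ₀ + Σ gᵢσᵢ + Σ hⱼtⱼ)` is the zero polynomial (`SOS.Poly.checkG`, ONE reduction). [folklore] -/
theorem deg2_A_K13postD10_vlevD5o2_V_pos_check : checkG deg2_A_K13postD10_vlevD5o2_V_pos_p deg2_A_K13postD10_vlevD5o2_V_pos_gs deg2_A_K13postD10_vlevD5o2_V_pos_hs deg2_A_K13postD10_vlevD5o2_V_pos_cert = true := by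
  decide +kernel

/-- KERNEL CHECK `deg2_A_K13postD10_vlevD5o2_Vdot_neg`: every Gram block passes `PSD.IsGramCertDD` and the residual `p − (σ₀ + Σ gᵢσᵢ + Σ hⱼtⱼ)` is the zero polynomial (`SOS.Poly.checkG`, ONE reduction). [folklore] -/
theorem deg2_A_K13postD10_vlevD5o2_Vdot_neg_check : checkG deg2_A_K13postD10_vlevD5o2_Vdot_neg_p deg2_A_K13postD10_vlevD5o2_Vdot_neg_gs deg2_A_K13postD10_vlevD5o2_Vdot_neg_hs deg2_A_K13postD10_vlevD5o2_Vdot_neg_cert = true := by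
  decide +kernel

/-- KERNEL CHECK `deg2_A_K13postD10_vlevD5o2_level_in_ball`: every Gram block passes `PSD.IsGramCertDD` and the residual `p − (σ₀ + Σ gᵢσᵢ + Σ hⱼtⱼ)` is the zero polynomial (`SOS.Poly.checkG`, ONE reduction). [folklore] -/
theorem deg2_A_K13postD10_vlevD5o2_level_in_ball_check : checkG deg2_A_K13postD10_vlevD5o2_level_in_ball_p deg2_A_K13postD10_vlevD5o2_level_in_ball_gs deg2_A_K13postD10_vlevD5o2_level_in_ball_hs deg2_A_K13postD10_vlevD5o2_level_in_ball_cert = true := by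
  decide +kernel

/-- KERNEL CHECK `deg2_A_K13postD10_vlevD5o2_arc_excl`: every Gram block passes `PSD.IsGramCertDD` and the residual `p − (σ₀ + Σ gᵢσᵢ + Σ hⱼtⱼ)` is the zero polynomial (`SOS.Poly.checkG`, ONE reduction). [folklore] -/
theorem deg2_A_K13postD10_vlevD5o2_arc_excl_check : checkG deg2_A_K13postD10_vlevD5o2_arc_excl_p deg2_A_K13postD10_vlevD5o2_arc_excl_gs deg2_A_K13postD10_vlevD5o2_arc_excl_hs deg2_A_K13postD10_vlevD5o2_arc_excl_cert = true := by
  decide +kernel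

/-- KERNEL CHECK `deg2_A_K13postD10_vlevD5o2_incl_record`: every Gram block passes `PSD.IsGramCertDD` and the residual `p − (σ₀ + Σ gᵢσᵢ + Σ hⱼtⱼ)` is the zero polynomial (`SOS.Poly.checkG`, ONE reduction). [folklore] -/
theorem deg2_A_K13postD10_vlevD5o2_incl_record_check : checkG deg2_A_K13postD10_vlevD5o2_incl_record_p deg2_A_K13postD10_vlevD5o2_incl_record_gs deg2_A_K13postD10_vlevD5o2_incl_record_hs deg2_A_K13postD10_vlevD5o2_incl_record_cert = true := by
  decide +kernel

/-- KERNEL CHECK `deg2_A_K13postD10_vlevD5o2_shape_in`: every Gram block passes `PSD.IsGramCertDD` and the residual `p − (σ₀ + Σ gᵢσᵢ + Σ hⱼtⱼ)` is the zero polynomial (`SOS.Poly.checkG`, ONE reduction). [folklore] -/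
theorem deg2_A_K13postD10_vlevD5o2_shape_in_check : checkG deg2_A_K13postD10_vlevD5o2_shape_in_p deg2_A_K13postD10_vlevD5o2_shape_in_gs deg2_A_K13postD10_vlevD5o2_shape_in_hs deg2_A_K13postD10_vlevD5o2_shape_in_cert = true := by
  decide +kernel

/-- **`deg2_A_K13postD10_vlevD5o2_V_pos`** (CERTIFIED, model `SMIB instance SMIB-K13post-D10 (model-1 I2
file, f verbatim)`; ALGEBRAIC inequality, ROA inclusion pending Lyapunov/ lemma): V - eps_pos*phi >=
0 on {h = 0} — for every real point satisfying the listed hypotheses (hh). [folklore] -/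
theorem deg2_A_K13postD10_vlevD5o2_V_pos (sigma kappa omega : ℝ) (hh : deg2_A_K13postD10_vlevD5o2_h sigma kappa omega = 0) :
    (1 / 400 : ℝ) * (((1 : ℝ) / 36) * omega ^ 2 + (1 : ℝ) * kappa ^ 2 + (1 : ℝ) * sigma ^ 2) ≤ deg2_A_K13postD10_vlevD5o2_V sigma kappa omega := by
  simp only [deg2_A_K13postD10_vlevD5o2_V, deg2_A_K13postD10_vlevD5o2_V_poly, eval_cons, eval_nil, Monomial.eval_eq, Monomial.evalFrom_cons, Monomial.evalFrom_nil,
        vars_cons_zero, vars_cons_succ]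
  push_cast
  simp only [deg2_A_K13postD10_vlevD5o2_h, deg2_A_K13postD10_vlevD5o2_h_poly, eval_cons, eval_nil, Monomial.eval_eq, Monomial.evalFrom_cons, Monomial.evalFrom_nil,
        vars_cons_zero, vars_cons_succ] at hh
  push_cast at hh
  have h := nonneg_of_checkG deg2_A_K13postD10_vlevD5o2_V_pos_check (vars [sigma, kappa, omega])
    (by simp [deg2_A_K13postD10_vlevD5o2_V_pos_gs])
    (by
      intro q hq
      simp only [deg2_A_K13postD10_vlevD5o2_V_pos_hs, List.mem_cons, List.not_mem_nil, or_false] at hq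
      rcases hq with rfl
      · simp only [eval_cons, eval_nil, Monomial.eval_eq, Monomial.evalFrom_cons, Monomial.evalFrom_nil,
        vars_cons_zero, vars_cons_succ]
        push_cast
        linear_combination hh)
  simp only [deg2_A_K13postD10_vlevD5o2_V_pos_p, eval_cons, eval_nil, Monomial.eval_eq, Monomial.evalFrom_cons, Monomial.evalFrom_nil,
        vars_cons_zero, vars_cons_succ] at h
  push_cast at h
  linear_combination h

/-- **`deg2_A_K13postD10_vlevD5o2_Vdot_neg`** (CERTIFIED, model `SMIB instance SMIB-K13post-D10 (model-1
I2 file, f verbatim)`; ALGEBRAIC inequality, ROA inclusion pending Lyapunov/ lemma): -Vdot -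
eps_dot*phi >= 0 on {1 - V >= 0} cap {r2 - phi >= 0} cap {h = 0} (Vdot = grad V . f; the second
hypothesis is the declared domain D, implied on the piece by level_in_ball) — for every real point
satisfying the listed hypotheses (hV, hD1, hh). [folklore] -/
theorem deg2_A_K13postD10_vlevD5o2_Vdot_neg (sigma kappa omega : ℝ) (hV : deg2_A_K13postD10_vlevD5o2_V sigma kappa omega ≤ (1 : ℝ)) (hD1 : 0 ≤ ((-1 : ℝ) / 36) * omega ^ 2 + (-1 : ℝ) * kappa ^ 2 + (-1 : ℝ) * sigma ^ 2 + ((5 : ℝ) / 2)) (hh : deg2_A_K13postD10_vlevD5o2_h sigma kappa omega = 0) :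
    deg2_A_K13postD10_vlevD5o2_Vdot sigma kappa omega ≤ -(1 / 8000 : ℝ) * (((1 : ℝ) / 36) * omega ^ 2 + (1 : ℝ) * kappa ^ 2 + (1 : ℝ) * sigma ^ 2) := by
  simp only [deg2_A_K13postD10_vlevD5o2_Vdot, deg2_A_K13postD10_vlevD5o2_Vdot_poly, eval_cons, eval_nil, Monomial.eval_eq, Monomial.evalFrom_cons, Monomial.evalFrom_nil,
        vars_cons_zero, vars_cons_succ]
  push_cast
  simp only [deg2_A_K13postD10_vlevD5o2_V, deg2_A_K13postD10_vlevD5o2_V_poly, eval_cons, eval_nil, Monomial.eval_eq, Monomial.evalFrom_cons, Monomial.evalFrom_nil,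
        vars_cons_zero, vars_cons_succ] at hV
  push_cast at hV
  simp only [deg2_A_K13postD10_vlevD5o2_h, deg2_A_K13postD10_vlevD5o2_h_poly, eval_cons, eval_nil, Monomial.eval_eq, Monomial.evalFrom_cons, Monomial.evalFrom_nil,
        vars_cons_zero, vars_cons_succ] at hh
  push_cast at hh
  have h := nonneg_of_checkG deg2_A_K13postD10_vlevD5o2_Vdot_neg_check (vars [sigma, kappa, omega])
    (by
      intro g hg
      simp only [deg2_A_K13postD10_vlevD5o2_Vdot_neg_gs, List.mem_cons, List.not_mem_nil, or_false] at hg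
      rcases hg with rfl | rfl
      · simp only [eval_cons, eval_nil, Monomial.eval_eq, Monomial.evalFrom_cons, Monomial.evalFrom_nil,
        vars_cons_zero, vars_cons_succ]
        push_cast
        linear_combination hV
      · simp only [eval_cons, eval_nil, Monomial.eval_eq, Monomial.evalFrom_cons, Monomial.evalFrom_nil,
        vars_cons_zero, vars_cons_succ]
        push_cast
        linear_combination hD1)
    (by
      intro q hq
      simp only [deg2_A_K13postD10_vlevD5o2_Vdot_neg_hs, List.mem_cons, List.not_mem_nil, or_false] at hq
      rcases hq with rfl
      · simp only [eval_cons, eval_nil, Monomial.eval_eq, Monomial.evalFrom_cons, Monomial.evalFrom_nil,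
        vars_cons_zero, vars_cons_succ]
        push_cast
        linear_combination hh)
  simp only [deg2_A_K13postD10_vlevD5o2_Vdot_neg_p, eval_cons, eval_nil, Monomial.eval_eq, Monomial.evalFrom_cons, Monomial.evalFrom_nil,
        vars_cons_zero, vars_cons_succ] at h
  push_cast at h
  linear_combination h

/-- **`deg2_A_K13postD10_vlevD5o2_level_in_ball`** (CERTIFIED, model `SMIB instance SMIB-K13post-D10
(model-1 I2 file, f verbatim)`; ALGEBRAIC inequality, ROA inclusion pending Lyapunov/ lemma): r2 -
phi >= 0 on {1 - V >= 0} cap {h = 0} (typed inclusion of the piece {V <= 1} cap {h = 0} in D = {phi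
<= r2}, r2 = 5/2) — for every real point satisfying the listed hypotheses (hV, hh). [folklore] -/
theorem deg2_A_K13postD10_vlevD5o2_level_in_ball (sigma kappa omega : ℝ) (hV : deg2_A_K13postD10_vlevD5o2_V sigma kappa omega ≤ (1 : ℝ)) (hh : deg2_A_K13postD10_vlevD5o2_h sigma kappa omega = 0) :
    ((1 : ℝ) / 36) * omega ^ 2 + (1 : ℝ) * kappa ^ 2 + (1 : ℝ) * sigma ^ 2 ≤ (5 / 2 : ℝ) := by
  simp only [deg2_A_K13postD10_vlevD5o2_V, deg2_A_K13postD10_vlevD5o2_V_poly, eval_cons, eval_nil, Monomial.eval_eq, Monomial.evalFrom_cons, Monomial.evalFrom_nil,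
        vars_cons_zero, vars_cons_succ] at hV
  push_cast at hV
  simp only [deg2_A_K13postD10_vlevD5o2_h, deg2_A_K13postD10_vlevD5o2_h_poly, eval_cons, eval_nil, Monomial.eval_eq, Monomial.evalFrom_cons, Monomial.evalFrom_nil,
        vars_cons_zero, vars_cons_succ] at hh
  push_cast at hh
  have h := nonneg_of_checkG deg2_A_K13postD10_vlevD5o2_level_in_ball_check (vars [sigma, kappa, omega])
    (by
      intro g hg
      simp only [deg2_A_K13postD10_vlevD5o2_level_in_ball_gs, List.mem_cons, List.not_mem_nil, or_false] at hg
      rcases hg with rfl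
      · simp only [eval_cons, eval_nil, Monomial.eval_eq, Monomial.evalFrom_cons, Monomial.evalFrom_nil,
        vars_cons_zero, vars_cons_succ]
        push_cast
        linear_combination hV)
    (by
      intro q hq
      simp only [deg2_A_K13postD10_vlevD5o2_level_in_ball_hs, List.mem_cons, List.not_mem_nil, or_false] at hq
      rcases hq with rfl
      · simp only [eval_cons, eval_nil, Monomial.eval_eq, Monomial.evalFrom_cons, Monomial.evalFrom_nil,
        vars_cons_zero, vars_cons_succ]
        push_cast
        linear_combination hh)
  simp only [deg2_A_K13postD10_vlevD5o2_level_in_ball_p, eval_cons, eval_nil, Monomial.eval_eq, Monomial.evalFrom_cons, Monomial.evalFrom_nil,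
        vars_cons_zero, vars_cons_succ] at h
  push_cast at h
  linear_combination h

/-- **`deg2_A_K13postD10_vlevD5o2_arc_excl`** (CERTIFIED, model `SMIB instance SMIB-K13post-D10 (model-1
I2 file, f verbatim)`; ALGEBRAIC inequality, ROA inclusion pending Lyapunov/ lemma): kappa_max -
kappa >= 0 on {1 - V >= 0} cap {h = 0} (arc exclusion kappa = 1 - cos(u) <= kappa_max = 1) — for
every real point satisfying the listed hypotheses (hV, hh). [folklore] -/
theorem deg2_A_K13postD10_vlevD5o2_arc_excl (sigma kappa omega : ℝ) (hV : deg2_A_K13postD10_vlevD5o2_V sigma kappa omega ≤ (1 : ℝ)) (hh : deg2_A_K13postD10_vlevD5o2_h sigma kappa omega = 0) :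
    kappa ≤ (1 : ℝ) := by
  simp only [deg2_A_K13postD10_vlevD5o2_V, deg2_A_K13postD10_vlevD5o2_V_poly, eval_cons, eval_nil, Monomial.eval_eq, Monomial.evalFrom_cons, Monomial.evalFrom_nil,
        vars_cons_zero, vars_cons_succ] at hV
  push_cast at hV
  simp only [deg2_A_K13postD10_vlevD5o2_h, deg2_A_K13postD10_vlevD5o2_h_poly, eval_cons, eval_nil, Monomial.eval_eq, Monomial.evalFrom_cons, Monomial.evalFrom_nil,
        vars_cons_zero, vars_cons_succ] at hh
  push_cast at hh
  have h := nonneg_of_checkG deg2_A_K13postD10_vlevD5o2_arc_excl_check (vars [sigma, kappa, omega])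
    (by
      intro g hg
      simp only [deg2_A_K13postD10_vlevD5o2_arc_excl_gs, List.mem_cons, List.not_mem_nil, or_false] at hg
      rcases hg with rfl
      · simp only [eval_cons, eval_nil, Monomial.eval_eq, Monomial.evalFrom_cons, Monomial.evalFrom_nil,
        vars_cons_zero, vars_cons_succ]
        push_cast
        linear_combination hV)
    (by
      intro q hq
      simp only [deg2_A_K13postD10_vlevD5o2_arc_excl_hs, List.mem_cons, List.not_mem_nil, or_false] at hq
      rcases hq with rfl
      · simp only [eval_cons, eval_nil, Monomial.eval_eq, Monomial.evalFrom_cons, Monomial.evalFrom_nil,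
        vars_cons_zero, vars_cons_succ]
        push_cast
        linear_combination hh)
  simp only [deg2_A_K13postD10_vlevD5o2_arc_excl_p, eval_cons, eval_nil, Monomial.eval_eq, Monomial.evalFrom_cons, Monomial.evalFrom_nil,
        vars_cons_zero, vars_cons_succ] at h
  push_cast at h
  linear_combination h

/-- **`deg2_A_K13postD10_vlevD5o2_incl_record`** (CERTIFIED, model `SMIB instance SMIB-K13post-D10
(model-1 I2 file, f verbatim)`; ALGEBRAIC inequality, ROA inclusion pending Lyapunov/ lemma): 1 - V
>= 0 on {c_rec - V_rec >= 0} cap {r2_rec - phi >= 0} cap {h = 0}: the RECORD piece {V_rec <= 29/10}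
cap {phi <= 7/4} cap {h = 0} of SMIB-deg2-A-K13postD10-domD7o4-L29o10 (sha256 4900be4c66c904c3...)
lies INSIDE the new piece {V <= 1} (V LEVER: certified set inclusion, not a level comparison) — for
every real point satisfying the listed hypotheses (hX1, hX2, hh). [folklore] -/
theorem deg2_A_K13postD10_vlevD5o2_incl_record (sigma kappa omega : ℝ) (hX1 : 0 ≤ ((-387 : ℝ) / 2500) * omega ^ 2 + ((-1767 : ℝ) / 10000) * kappa * omega + ((-853 : ℝ) / 625) * kappa ^ 2 + ((-3369 : ℝ) / 10000) * sigma * omega + ((5057 : ℝ) / 1000) * sigma * kappa + ((-37661 : ℝ) / 10000) * sigma ^ 2 + ((-34077 : ℝ) / 10000) * kappa + ((29 : ℝ) / 10)) (hX2 : 0 ≤ ((-1 : ℝ) / 36) * omega ^ 2 + (-1 : ℝ) * kappa ^ 2 + (-1 : ℝ) * sigma ^ 2 + ((7 : ℝ) / 4)) (hh : deg2_A_K13postD10_vlevD5o2_h sigma kappa omega = 0) :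
    0 ≤ ((-359 : ℝ) / 10000) * omega ^ 2 + ((-859 : ℝ) / 10000) * kappa * omega + ((2407 : ℝ) / 5000) * kappa ^ 2 + ((-221 : ℝ) / 2500) * sigma * omega + ((3403 : ℝ) / 5000) * sigma * kappa + ((-6181 : ℝ) / 2500) * kappa + (1 : ℝ) := by
  simp only [deg2_A_K13postD10_vlevD5o2_h, deg2_A_K13postD10_vlevD5o2_h_poly, eval_cons, eval_nil, Monomial.eval_eq, Monomial.evalFrom_cons, Monomial.evalFrom_nil,
        vars_cons_zero, vars_cons_succ] at hh
  push_cast at hh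
  have h := nonneg_of_checkG deg2_A_K13postD10_vlevD5o2_incl_record_check (vars [sigma, kappa, omega])
    (by
      intro g hg
      simp only [deg2_A_K13postD10_vlevD5o2_incl_record_gs, List.mem_cons, List.not_mem_nil, or_false] at hg
      rcases hg with rfl | rfl
      · simp only [eval_cons, eval_nil, Monomial.eval_eq, Monomial.evalFrom_cons, Monomial.evalFrom_nil,
        vars_cons_zero, vars_cons_succ]
        push_cast
        linear_combination hX1
      · simp only [eval_cons, eval_nil, Monomial.eval_eq, Monomial.evalFrom_cons, Monomial.evalFrom_nil,
        vars_cons_zero, vars_cons_succ]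
        push_cast
        linear_combination hX2)
    (by
      intro q hq
      simp only [deg2_A_K13postD10_vlevD5o2_incl_record_hs, List.mem_cons, List.not_mem_nil, or_false] at hq
      rcases hq with rfl
      · simp only [eval_cons, eval_nil, Monomial.eval_eq, Monomial.evalFrom_cons, Monomial.evalFrom_nil,
        vars_cons_zero, vars_cons_succ]
        push_cast
        linear_combination hh)
  simp only [deg2_A_K13postD10_vlevD5o2_incl_record_p, eval_cons, eval_nil, Monomial.eval_eq, Monomial.evalFrom_cons, Monomial.evalFrom_nil,
        vars_cons_zero, vars_cons_succ] at h
  push_cast at h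
  linear_combination h

/-- **`deg2_A_K13postD10_vlevD5o2_shape_in`** (CERTIFIED, model `SMIB instance SMIB-K13post-D10 (model-1
I2 file, f verbatim)`; ALGEBRAIC inequality, ROA inclusion pending Lyapunov/ lemma): 1 - V >= 0 on
{beta - phi_shape >= 0} cap {h = 0}: the shape set {phi_shape <= beta} cap {h = 0} (phi_shape =
sigma^2 + kappa^2 + (1/36)*omega^2, beta = 5/8) lies INSIDE the new piece {V <= 1} (inscribed-shape
radius; the alternation's objective) — for every real point satisfying the listed hypotheses (hX1,
hh). [folklore] -/
theorem deg2_A_K13postD10_vlevD5o2_shape_in (sigma kappa omega : ℝ) (hX1 : 0 ≤ ((-1 : ℝ) / 36) * omega ^ 2 + (-1 : ℝ) * kappa ^ 2 + (-1 : ℝ) * sigma ^ 2 + ((5 : ℝ) / 8)) (hh : deg2_A_K13postD10_vlevD5o2_h sigma kappa omega = 0) :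
    0 ≤ ((-359 : ℝ) / 10000) * omega ^ 2 + ((-859 : ℝ) / 10000) * kappa * omega + ((2407 : ℝ) / 5000) * kappa ^ 2 + ((-221 : ℝ) / 2500) * sigma * omega + ((3403 : ℝ) / 5000) * sigma * kappa + ((-6181 : ℝ) / 2500) * kappa + (1 : ℝ) := by
  simp only [deg2_A_K13postD10_vlevD5o2_h, deg2_A_K13postD10_vlevD5o2_h_poly, eval_cons, eval_nil, Monomial.eval_eq, Monomial.evalFrom_cons, Monomial.evalFrom_nil,
        vars_cons_zero, vars_cons_succ] at hh
  push_cast at hh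
  have h := nonneg_of_checkG deg2_A_K13postD10_vlevD5o2_shape_in_check (vars [sigma, kappa, omega])
    (by
      intro g hg
      simp only [deg2_A_K13postD10_vlevD5o2_shape_in_gs, List.mem_cons, List.not_mem_nil, or_false] at hg
      rcases hg with rfl
      · simp only [eval_cons, eval_nil, Monomial.eval_eq, Monomial.evalFrom_cons, Monomial.evalFrom_nil,
        vars_cons_zero, vars_cons_succ]
        push_cast
        linear_combination hX1)
    (by
      intro q hq
      simp only [deg2_A_K13postD10_vlevD5o2_shape_in_hs, List.mem_cons, List.not_mem_nil, or_false] at hq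
      rcases hq with rfl
      · simp only [eval_cons, eval_nil, Monomial.eval_eq, Monomial.evalFrom_cons, Monomial.evalFrom_nil,
        vars_cons_zero, vars_cons_succ]
        push_cast
        linear_combination hh)
  simp only [deg2_A_K13postD10_vlevD5o2_shape_in_p, eval_cons, eval_nil, Monomial.eval_eq, Monomial.evalFrom_cons, Monomial.evalFrom_nil,
        vars_cons_zero, vars_cons_succ] at h
  push_cast at h
  linear_combination h

/-- **Certificate `SMIB-deg2-A-K13postD10-vlevD5o2`** (CERTIFIED, model `SMIB instance SMIB-K13post-D10
(model-1 I2 file, f verbatim)`; README §3 T3 shape): under the listed hypotheses (hh, hV, hD1, hX1,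
hX2, hX1_shape_in) all 6 certified inequalities hold. «algebraic inequalities certified; ROA
inclusion pending Lyapunov/ lemma» (PARTITION A2). [folklore] -/
theorem deg2_A_K13postD10_vlevD5o2_certificate (sigma kappa omega : ℝ) (hh : deg2_A_K13postD10_vlevD5o2_h sigma kappa omega = 0) (hV : deg2_A_K13postD10_vlevD5o2_V sigma kappa omega ≤ (1 : ℝ)) (hD1 : 0 ≤ ((-1 : ℝ) / 36) * omega ^ 2 + (-1 : ℝ) * kappa ^ 2 + (-1 : ℝ) * sigma ^ 2 + ((5 : ℝ) / 2)) (hX1 : 0 ≤ ((-387 : ℝ) / 2500) * omega ^ 2 + ((-1767 : ℝ) / 10000) * kappa * omega + ((-853 : ℝ) / 625) * kappa ^ 2 + ((-3369 : ℝ) / 10000) * sigma * omega + ((5057 : ℝ) / 1000) * sigma * kappa + ((-37661 : ℝ) / 10000) * sigma ^ 2 + ((-34077 : ℝ) / 10000) * kappa + ((29 : ℝ) / 10)) (hX2 : 0 ≤ ((-1 : ℝ) / 36) * omega ^ 2 + (-1 : ℝ) * kappa ^ 2 + (-1 : ℝ) * sigma ^ 2 + ((7 : ℝ) / 4)) (hX1_shape_in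 : 0 ≤ ((-1 : ℝ) / 36) * omega ^ 2 + (-1 : ℝ) * kappa ^ 2 + (-1 : ℝ) * sigma ^ 2 + ((5 : ℝ) / 8)) :
    (1 / 400 : ℝ) * (((1 : ℝ) / 36) * omega ^ 2 + (1 : ℝ) * kappa ^ 2 + (1 : ℝ) * sigma ^ 2) ≤ deg2_A_K13postD10_vlevD5o2_V sigma kappa omega ∧
    deg2_A_K13postD10_vlevD5o2_Vdot sigma kappa omega ≤ -(1 / 8000 : ℝ) * (((1 : ℝ) / 36) * omega ^ 2 + (1 : ℝ) * kappa ^ 2 + (1 : ℝ) * sigma ^ 2) ∧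
    ((1 : ℝ) / 36) * omega ^ 2 + (1 : ℝ) * kappa ^ 2 + (1 : ℝ) * sigma ^ 2 ≤ (5 / 2 : ℝ) ∧
    kappa ≤ (1 : ℝ) ∧
    0 ≤ ((-359 : ℝ) / 10000) * omega ^ 2 + ((-859 : ℝ) / 10000) * kappa * omega + ((2407 : ℝ) / 5000) * kappa ^ 2 + ((-221 : ℝ) / 2500) * sigma * omega + ((3403 : ℝ) / 5000) * sigma * kappa + ((-6181 : ℝ) / 2500) * kappa + (1 : ℝ) ∧
    0 ≤ ((-359 : ℝ) / 10000) * omega ^ 2 + ((-859 : ℝ) / 10000) * kappa * omega + ((2407 : ℝ) / 5000) * kappa ^ 2 + ((-221 : ℝ) / 2500) * sigma * omega + ((3403 : ℝ) / 5000) * sigma * kappa + ((-6181 : ℝ) / 2500) * kappa + (1 : ℝ) :=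
  ⟨deg2_A_K13postD10_vlevD5o2_V_pos sigma kappa omega hh, deg2_A_K13postD10_vlevD5o2_Vdot_neg sigma kappa omega hV hD1 hh, deg2_A_K13postD10_vlevD5o2_level_in_ball sigma kappa omega hV hh, deg2_A_K13postD10_vlevD5o2_arc_excl sigma kappa omega hV hh, deg2_A_K13postD10_vlevD5o2_incl_record sigma kappa omega hX1 hX2 hh, deg2_A_K13postD10_vlevD5o2_shape_in sigma kappa omega hX1_shape_in hh⟩

/-- `deg2_A_K13postD10_vlevD5o2_f_sigma` written out as an explicit real polynomial (2 terms). [folklore] -/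
theorem deg2_A_K13postD10_vlevD5o2_f_sigma_eq (sigma kappa omega : ℝ) :
    deg2_A_K13postD10_vlevD5o2_f_sigma sigma kappa omega = (-1 : ℝ) * kappa * omega + (1 : ℝ) * omega := by
  simp only [deg2_A_K13postD10_vlevD5o2_f_sigma, deg2_A_K13postD10_vlevD5o2_f_sigma_poly, eval_cons, eval_nil, Monomial.eval_eq, Monomial.evalFrom_cons, Monomial.evalFrom_nil,
        vars_cons_zero, vars_cons_succ]
  push_cast
  ring

/-- `deg2_A_K13postD10_vlevD5o2_f_kappa` written out as an explicit real polynomial (1 terms). [folklore] -/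
theorem deg2_A_K13postD10_vlevD5o2_f_kappa_eq (sigma kappa omega : ℝ) :
    deg2_A_K13postD10_vlevD5o2_f_kappa sigma kappa omega = (1 : ℝ) * sigma * omega := by
  simp only [deg2_A_K13postD10_vlevD5o2_f_kappa, deg2_A_K13postD10_vlevD5o2_f_kappa_poly, eval_cons, eval_nil, Monomial.eval_eq, Monomial.evalFrom_cons, Monomial.evalFrom_nil,
        vars_cons_zero, vars_cons_succ]
  push_cast
  ring

/-- `deg2_A_K13postD10_vlevD5o2_f_omega` written out as an explicit real polynomial (3 terms). [folklore] -/
theorem deg2_A_K13postD10_vlevD5o2_f_omega_eq (sigma kappa omega : ℝ) :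
    deg2_A_K13postD10_vlevD5o2_f_omega sigma kappa omega = ((-10 : ℝ) / 7) * omega + ((4303847457 : ℝ) / 88791425) * kappa + ((-532761715096 : ℝ) / 15538499375) * sigma := by
  simp only [deg2_A_K13postD10_vlevD5o2_f_omega, deg2_A_K13postD10_vlevD5o2_f_omega_poly, eval_cons, eval_nil, Monomial.eval_eq, Monomial.evalFrom_cons, Monomial.evalFrom_nil,
        vars_cons_zero, vars_cons_succ]
  push_cast
  ring

/-- `deg2_A_K13postD10_vlevD5o2_h` written out as an explicit real polynomial (3 terms). [folklore] -/
theorem deg2_A_K13postD10_vlevD5o2_h_eq (sigma kappa omega : ℝ) :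
    deg2_A_K13postD10_vlevD5o2_h sigma kappa omega = (1 : ℝ) * kappa ^ 2 + (1 : ℝ) * sigma ^ 2 + (-2 : ℝ) * kappa := by
  simp only [deg2_A_K13postD10_vlevD5o2_h, deg2_A_K13postD10_vlevD5o2_h_poly, eval_cons, eval_nil, Monomial.eval_eq, Monomial.evalFrom_cons, Monomial.evalFrom_nil,
        vars_cons_zero, vars_cons_succ]
  push_cast
  ring

/-- `deg2_A_K13postD10_vlevD5o2_V` written out as an explicit real polynomial (6 terms). [folklore] -/
theorem deg2_A_K13postD10_vlevD5o2_V_eq (sigma kappa omega : ℝ) :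
    deg2_A_K13postD10_vlevD5o2_V sigma kappa omega = ((359 : ℝ) / 10000) * omega ^ 2 + ((859 : ℝ) / 10000) * kappa * omega + ((-2407 : ℝ) / 5000) * kappa ^ 2 + ((221 : ℝ) / 2500) * sigma * omega + ((-3403 : ℝ) / 5000) * sigma * kappa + ((6181 : ℝ) / 2500) * kappa := by
  simp only [deg2_A_K13postD10_vlevD5o2_V, deg2_A_K13postD10_vlevD5o2_V_poly, eval_cons, eval_nil, Monomial.eval_eq, Monomial.evalFrom_cons, Monomial.evalFrom_nil,
        vars_cons_zero, vars_cons_succ]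
  push_cast
  ring

/-- `deg2_A_K13postD10_vlevD5o2_Vdot` written out as an explicit real polynomial (11 terms). [folklore] -/
theorem deg2_A_K13postD10_vlevD5o2_Vdot_eq (sigma kappa omega : ℝ) :
    deg2_A_K13postD10_vlevD5o2_Vdot sigma kappa omega = ((-221 : ℝ) / 2500) * kappa * omega ^ 2 + ((3403 : ℝ) / 5000) * kappa ^ 2 * omega + ((859 : ℝ) / 10000) * sigma * omega ^ 2 + ((-2407 : ℝ) / 2500) * sigma * kappa * omega + ((-3403 : ℝ) / 5000) * sigma ^ 2 * omega + ((-62 : ℝ) / 4375) * omega ^ 2 + ((8319108954141 : ℝ) / 3107699875000) * kappa * omega + ((3697004965563 : ℝ) / 887914250000) * kappa ^ 2 + ((-641855636301 : ℝ) / 5549464062500) * sigma * omega + ((52040722082609 : ℝ) / 38846248437500) * sigma * kappa + ((-1731475574062 : ℝ) / 571268359375) * sigma ^ 2 := by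
  simp only [deg2_A_K13postD10_vlevD5o2_Vdot, deg2_A_K13postD10_vlevD5o2_Vdot_poly, eval_cons, eval_nil, Monomial.eval_eq, Monomial.evalFrom_cons, Monomial.evalFrom_nil,
        vars_cons_zero, vars_cons_succ]
  push_cast
  ring

end Summit.Ventures.GridStability.Bench.SMIB
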